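import Mathlib
import HarnessLib

/-!
# Coffey–Csordas (2013), 2.5: the Jacobi theta function `Φ` and the derivatives of its series

Source: M. W. Coffey and G. Csordas, *On the log-concavity of a Jacobi theta function*, Math. Comp. **82**
(2013), no. 284, 2265–2272, doi:10.1090/S0025-5718-2013-02681-6 [CoffeyCsordas2013] — p. 2265 (1.1)–(1.2) (the
function `Φ`), p. 2269 (their statement 2.5 = (2.19) for every `n ≥ 1`); restated verbatim as Open Problem 4.13 of
G. Csordas, *Fourier transforms of positive definite kernels and the Riemann ξ-function*, CMFT **15** (2015),
arXiv:1309.0055 [Csordas2015].  PRIMARY READ (AMS open PDF, pp. 2265 and 2269) by the producing system, 2026-08-18.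

The published statement (p. 2269, verbatim): "**2.5.** The derivatives of the Jacobi theta function, Φ(t), are (strictly)
log-concave on ℝ.  That is, for each n ∈ ℕ, (2.19) `S_n(t) = (Φ⁽ⁿ⁾(t))² − Φ⁽ⁿ⁻¹⁾(t)Φ⁽ⁿ⁺¹⁾(t) > 0` for t ∈ ℝ."
(`ℕ = {1, 2, …}` there; `n = 1` is their Theorem 2.1), with (p. 2265, (1.2)) `Φ(t) := Σ_{n ≥ 1} a_n(t)`,
`a_n(t) = (2π²n⁴e^{9t} − 3πn²e^{5t})·exp(−πn²e^{4t})` ("we have deleted the usual, inconsequential, factors of 2"),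
so that `Ξ(x) = ∫₀^∞ Φ(t) cos(xt) dt`.  CATEGORY: an explicitly labelled conjecture of the paper, REFUTED by the
explicit witness `n = 9`, `t = 0`: `Φ` is even, so `Φ⁽⁹⁾(0) = 0`, while `Φ⁽⁸⁾(0) > 0` and `Φ⁽¹⁰⁾(0) > 0` (the sign
alternation of `Φ⁽²ᵐ⁾(0)` stops at `m = 5`), whence `S₉(0) = −Φ⁽⁸⁾(0)Φ⁽¹⁰⁾(0) ≈ −7.84·10¹⁹ < 0`.  (Evenness is not
used in the proof: `|Φ⁽⁹⁾(0)| ≤ 2 000 001` is proved instead.)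
Modelling conventions: `a n t` is (1.2) literally; `Φ t := ∑' n : ℕ, a (n+1) t` (absolutely convergent, so `tsum` is
the classical sum); `Φ⁽ⁿ⁾ := iteratedDeriv n Φ`, which by `iteratedDeriv_eqOn` IS the classical `n`-th derivative on
`(−1, 1)` (all that is evaluated); `S n t := (iteratedDeriv n Φ t)² − iteratedDeriv (n−1) Φ t · iteratedDeriv (n+1) Φ t`
is (2.19) (natural subtraction harmless as `n ≥ 1`); `AllDerivativesLogConcave := ∀ n ≥ 1, ∀ t, 0 < S n t`.

This module (§§1–4 of the bundle file): the objects `a`, `Φ`, `S`, `AllDerivativesLogConcave` (REFUTED in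
`Literature.Analysis.SpecialFunctions.CoffeyCsordas2013.Sign`; kept as a cited definition — tombstone — because the refutation names it; no `_holds` can exist);
`hasDerivAt_F`, `hasDerivAt_A`: with `E c m t := exp(m t − c e^{4t})`, `d/dt E c m = m·E c m − 4c·E c (m+4)`, so the
`k`-th derivative of `a_n` is an explicit finite combination `A n k` (`A_zero : A n 0 = a n`), `A n k 0 =
(polynomial in π, n)·e^{−πn²}` (`F_at_zero`, `T_eq`); `abs_A_le`, `summable_U`: a summable majorant of `|A n k t|`
uniformly on `|t| ≤ 1`; hence by termwise differentiation (`hasDerivAt_tsum_of_isPreconnected`) `hasDerivAt_Φk`,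
`iteratedDeriv_eqOn k : EqOn (iteratedDeriv k Φ) (Φk k) (Ioo (−1) 1)` and
`iteratedDeriv_zero_eq k : iteratedDeriv k Φ 0 = ∑' n, T k n`, `T k n = a_{n+1}⁽ᵏ⁾(0)`.

Modules: `Literature.Analysis.SpecialFunctions.CoffeyCsordas2013.Derivatives` (§§1–4: `a`, `Φ`, `S`, `AllDerivativesLogConcave`; closed form of all
derivatives of the summands, the summable majorant, termwise differentiation on `(−1,1)`:
`iteratedDeriv_zero_eq k : iteratedDeriv k Φ 0 = ∑' n, T k n`), `.Enclosures` (§§5–6: the head `n+1 ≤ 4` as integer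
polynomials in `π` times powers of `e^{−π}`, 20-digit rational enclosures, four `decide +kernel` evaluations),
`.Sign` (§§7–8: the tail bound, `233 377 300 ≤ Φ⁽⁸⁾(0)`, `3.34·10¹¹ ≤ Φ⁽¹⁰⁾(0)`, `|Φ⁽⁹⁾(0)| ≤ 2 000 001`,
`S_nine_zero_neg : S 9 0 < 0`, `allDerivativesLogConcave_false`).

Provenance: refutations bundle `papers/_cross/refutations` (H21 seat pub-refute-2, 2026-08-18), package module
`Refutations.CoffeyCsordas2013 (§§1–4)`, moved into the tree under the Lean-in-tree rule (human 2026-08-18); the witness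
was found by the bundle's numerics (`numerics/coffey_csordas2013/`, three independent high-precision checkers agree:
`Φ⁽⁸⁾(0) = 2.3338698091…·10⁸`, `Φ⁽¹⁰⁾(0) = 3.3582019884…·10¹¹`, `|Φ⁽⁹⁾(0)| ≤ 3.1·10⁻³⁴`, `S₉(0) ≤ −7.8376·10¹⁹`).
Renamed from the bundle: `Conjecture25 ↦ AllDerivativesLogConcave`, `conjecture25_false ↦ allDerivativesLogConcave_false`.
-/

set_option autoImplicit false

open Real Set Filter Topology

namespace Literature.Analysis.SpecialFunctions.CoffeyCsordas2013

noncomputable section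

/-! ## 1. The objects of the paper and the conjecture -/

/-- The summand `a_n(t) = (2π²n⁴e^{9t} − 3πn²e^{5t})·exp(−πn²e^{4t})` of (1.2). [cite: CoffeyCsordas2013, p. 2265 (1.2)] -/
def a (n : ℕ) (t : ℝ) : ℝ :=
  (2 * π ^ 2 * (n : ℝ) ^ 4 * exp (9 * t) - 3 * π * (n : ℝ) ^ 2 * exp (5 * t)) *
    exp (-(π * (n : ℝ) ^ 2 * exp (4 * t)))

/-- The Jacobi theta function `Φ(t) = ∑_{n ≥ 1} a_n(t)` of (1.2). [cite: CoffeyCsordas2013, p. 2265 (1.2)] -/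
def Φ (t : ℝ) : ℝ := ∑' n : ℕ, a (n + 1) t

/-- `S_n(t) = (Φ⁽ⁿ⁾(t))² − Φ⁽ⁿ⁻¹⁾(t)·Φ⁽ⁿ⁺¹⁾(t)` of (2.19). [cite: CoffeyCsordas2013, p. 2269 (2.19)] -/
def S (n : ℕ) (t : ℝ) : ℝ :=
  iteratedDeriv n Φ t ^ 2 - iteratedDeriv (n - 1) Φ t * iteratedDeriv (n + 1) Φ t

/-- Statement 2.5 of Coffey–Csordas (2013), p. 2269 — (2.19) for EVERY `n ∈ ℕ = {1, 2, …}`: `S_n(t) > 0` for all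
real `t`.  **REFUTED in this tree:** `allDerivativesLogConcave_false` (module `Sign`,
witness `n = 9`, `t = 0`).  Kept as a cited definition because the refutation names it; no `_holds` can exist. [cite: CoffeyCsordas2013, p. 2269, 2.5] -/
def AllDerivativesLogConcave : Prop := ∀ n : ℕ, 1 ≤ n → ∀ t : ℝ, 0 < S n t

/-! ## 2. Closed form of the derivatives of the summands -/

/-- `E c m t = exp(m t − c e^{4t})`. [folklore] -/
def E (c m t : ℝ) : ℝ := exp (m * t - c * exp (4 * t))

/-- `F c k m` = the `k`-th derivative of `E c m` (Lemma `hasDerivAt_F`):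
`F c 0 m = E c m`, `F c (k+1) m = m·F c k m − 4c·F c k (m+4)`. [folklore] -/
def F (c : ℝ) : ℕ → ℝ → ℝ → ℝ
  | 0, m, t => E c m t
  | k + 1, m, t => m * F c k m t - 4 * c * F c k (m + 4) t

/-- `p c k m` = the polynomial factor of `F c k m 0 = p c k m · e^{−c}` (Lemma `F_at_zero`). [folklore] -/
def p (c : ℝ) : ℕ → ℝ → ℝ
  | 0, _ => 1
  | k + 1, m => m * p c k m - 4 * c * p c k (m + 4)

/-- Auxiliary lemma: `(c m t : ℝ) : E c (m + 4) t = exp (4 * t) * E c m t`. [folklore] -/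
theorem E_add_four (c m t : ℝ) : E c (m + 4) t = exp (4 * t) * E c m t := by
  rw [E, E, ← Real.exp_add]; congr 1; ring

/-- Auxiliary lemma: `(c m t : ℝ) : HasDerivAt (E c m) (m * E c m t - 4 * c * E c (m + 4) t) t`. [folklore] -/
theorem hasDerivAt_E (c m t : ℝ) :
    HasDerivAt (E c m) (m * E c m t - 4 * c * E c (m + 4) t) t := by
  have h4 : HasDerivAt (fun x : ℝ => 4 * x) (4 * 1) t := (hasDerivAt_id t).const_mul 4
  have he : HasDerivAt (fun x : ℝ => c * exp (4 * x)) (c * (exp (4 * t) * (4 * 1))) t :=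
    h4.exp.const_mul c
  have hm : HasDerivAt (fun x : ℝ => m * x) (m * 1) t := (hasDerivAt_id t).const_mul m
  have hsub : HasDerivAt (fun x : ℝ => m * x - c * exp (4 * x)) (m * 1 - c * (exp (4 * t) * (4 * 1))) t :=
    hm.sub he
  have h : HasDerivAt (E c m) (exp (m * t - c * exp (4 * t)) * (m * 1 - c * (exp (4 * t) * (4 * 1)))) t :=
    hsub.exp
  convert h using 1
  rw [E_add_four, E]; ring

/-- Auxiliary lemma: `(c : ℝ) (k : ℕ) : ∀ m t : ℝ, HasDerivAt (F c k m) (F c (k + 1) m t) t`. [folklore] -/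
theorem hasDerivAt_F (c : ℝ) (k : ℕ) : ∀ m t : ℝ, HasDerivAt (F c k m) (F c (k + 1) m t) t := by
  induction k with
  | zero => intro m t; exact hasDerivAt_E c m t
  | succ k ih =>
    intro m t
    have h := ((ih m t).const_mul m).sub ((ih (m + 4) t).const_mul (4 * c))
    exact h

/-- Auxiliary lemma: `(c : ℝ) (k : ℕ) : ∀ m : ℝ, F c k m 0 = p c k m * exp (-c)`. [folklore] -/
theorem F_at_zero (c : ℝ) (k : ℕ) : ∀ m : ℝ, F c k m 0 = p c k m * exp (-c) := by
  induction k with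
  | zero => intro m; simp [F, E, p]
  | succ k ih => intro m; simp only [F, p, ih]; ring

/-- Auxiliary lemma: `(c m t : ℝ) (hc : 0 ≤ c) (hm : 0 ≤ m) (ht : |t| ≤ 1) :`. [folklore] -/
theorem abs_E_le (c m t : ℝ) (hc : 0 ≤ c) (hm : 0 ≤ m) (ht : |t| ≤ 1) :
    |E c m t| ≤ exp (m - c * exp (-4)) := by
  rw [E, abs_of_pos (exp_pos _), exp_le_exp]
  obtain ⟨ht1, ht2⟩ := abs_le.mp ht
  have h1 : m * t ≤ m := by nlinarith
  have h2 : c * exp (-4) ≤ c * exp (4 * t) :=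
    mul_le_mul_of_nonneg_left (exp_le_exp.mpr (by linarith)) hc
  linarith

/-- Auxiliary lemma: `(c : ℝ) (hc : 0 ≤ c) (k : ℕ) : ∀ m t : ℝ, 0 ≤ m → |t| ≤ 1 →`. [folklore] -/
theorem abs_F_le (c : ℝ) (hc : 0 ≤ c) (k : ℕ) : ∀ m t : ℝ, 0 ≤ m → |t| ≤ 1 →
    |F c k m t| ≤ (m + 4 * c + 4 * k) ^ k * exp (m + 4 * k - c * exp (-4)) := by
  induction k with
  | zero => intro m t hm ht; simpa [F] using abs_E_le c m t hc hm ht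
  | succ k ih =>
    intro m t hm ht
    have h1 := ih m t hm ht
    have h2 := ih (m + 4) t (by linarith) ht
    have hc4 : (0 : ℝ) ≤ 4 * c := by linarith
    set X : ℝ := m + 4 * c + 4 * ((k : ℝ) + 1) with hX
    set Ex : ℝ := exp (m + 4 * ((k : ℝ) + 1) - c * exp (-4)) with hEx
    have hX0 : 0 ≤ m + 4 * c + 4 * (k : ℝ) := by positivity
    have hpow : (m + 4 * c + 4 * (k : ℝ)) ^ k ≤ X ^ k := pow_le_pow_left₀ hX0 (by linarith) k
    have hexp : exp (m + 4 * k - c * exp (-4)) ≤ Ex := exp_le_exp.mpr (by linarith)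
    have hX2 : m + 4 + 4 * c + 4 * (k : ℝ) = X := by rw [hX]; ring
    have hEx2 : exp (m + 4 + 4 * k - c * exp (-4)) = Ex := by rw [hEx]; congr 1; ring
    have hXk : 0 ≤ X ^ k := by positivity
    have hEx0 : 0 ≤ Ex := (exp_pos _).le
    push_cast
    calc |F c (k + 1) m t| = |m * F c k m t - 4 * c * F c k (m + 4) t| := rfl
      _ ≤ |m * F c k m t| + |4 * c * F c k (m + 4) t| := abs_sub _ _
      _ = m * |F c k m t| + 4 * c * |F c k (m + 4) t| := by
          rw [abs_mul, abs_mul, abs_of_nonneg hm, abs_of_nonneg hc4]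
      _ ≤ m * ((m + 4 * c + 4 * k) ^ k * exp (m + 4 * k - c * exp (-4)))
          + 4 * c * ((m + 4 + 4 * c + 4 * k) ^ k * exp (m + 4 + 4 * k - c * exp (-4))) := by
          gcongr
      _ ≤ m * (X ^ k * Ex) + 4 * c * (X ^ k * Ex) := by
          rw [hX2, hEx2]; gcongr
      _ = (m + 4 * c) * (X ^ k * Ex) := by ring
      _ ≤ X * (X ^ k * Ex) := by
          apply mul_le_mul_of_nonneg_right _ (mul_nonneg hXk hEx0); rw [hX]; linarith
      _ = X ^ (k + 1) * Ex := by ring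

/-- Auxiliary lemma: `(c : ℝ) (hc : 0 ≤ c) (k : ℕ) : ∀ m : ℝ, 0 ≤ m →`. [folklore] -/
theorem abs_p_le (c : ℝ) (hc : 0 ≤ c) (k : ℕ) : ∀ m : ℝ, 0 ≤ m →
    |p c k m| ≤ (m + 4 * c + 4 * k) ^ k := by
  induction k with
  | zero => intro m hm; simp [p]
  | succ k ih =>
    intro m hm
    have h1 := ih m hm
    have h2 := ih (m + 4) (by linarith)
    have hc4 : (0 : ℝ) ≤ 4 * c := by linarith
    set X : ℝ := m + 4 * c + 4 * ((k : ℝ) + 1) with hX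
    have hX0 : 0 ≤ m + 4 * c + 4 * (k : ℝ) := by positivity
    have hpow : (m + 4 * c + 4 * (k : ℝ)) ^ k ≤ X ^ k := pow_le_pow_left₀ hX0 (by linarith) k
    have hX2 : m + 4 + 4 * c + 4 * (k : ℝ) = X := by rw [hX]; ring
    have hXk : 0 ≤ X ^ k := by positivity
    push_cast
    calc |p c (k + 1) m| = |m * p c k m - 4 * c * p c k (m + 4)| := rfl
      _ ≤ |m * p c k m| + |4 * c * p c k (m + 4)| := abs_sub _ _
      _ = m * |p c k m| + 4 * c * |p c k (m + 4)| := by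
          rw [abs_mul, abs_mul, abs_of_nonneg hm, abs_of_nonneg hc4]
      _ ≤ m * (m + 4 * c + 4 * k) ^ k + 4 * c * (m + 4 + 4 * c + 4 * k) ^ k := by gcongr
      _ ≤ m * X ^ k + 4 * c * X ^ k := by rw [hX2]; gcongr
      _ = (m + 4 * c) * X ^ k := by ring
      _ ≤ X * X ^ k := by apply mul_le_mul_of_nonneg_right _ hXk; rw [hX]; linarith
      _ = X ^ (k + 1) := by ring

/-! ## 3. The derivatives of `a_n` and a uniform bound on `[-1, 1]` -/

/-- `A n k` = the `k`-th derivative of `a_n` (Lemma `hasDerivAt_A`, `A_zero`). [folklore] -/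
def A (n k : ℕ) (t : ℝ) : ℝ :=
  2 * π ^ 2 * (n : ℝ) ^ 4 * F (π * (n : ℝ) ^ 2) k 9 t - 3 * π * (n : ℝ) ^ 2 * F (π * (n : ℝ) ^ 2) k 5 t

/-- Auxiliary lemma: `(n : ℕ) : A n 0 = a n`. [folklore] -/
theorem A_zero (n : ℕ) : A n 0 = a n := by
  funext t
  simp only [A, F, E, a]
  rw [show (9 : ℝ) * t - π * (n : ℝ) ^ 2 * exp (4 * t) = 9 * t + -(π * (n : ℝ) ^ 2 * exp (4 * t)) by ring,
    Real.exp_add,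
    show (5 : ℝ) * t - π * (n : ℝ) ^ 2 * exp (4 * t) = 5 * t + -(π * (n : ℝ) ^ 2 * exp (4 * t)) by ring,
    Real.exp_add]
  ring

/-- Auxiliary lemma: `(n k : ℕ) (t : ℝ) : HasDerivAt (A n k) (A n (k + 1) t) t`. [folklore] -/
theorem hasDerivAt_A (n k : ℕ) (t : ℝ) : HasDerivAt (A n k) (A n (k + 1) t) t :=
  ((hasDerivAt_F _ k 9 t).const_mul _).sub ((hasDerivAt_F _ k 5 t).const_mul _)

/-- Uniform majorant of `|A n k t|` for `|t| ≤ 1`. [folklore] -/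
def U (n k : ℕ) : ℝ :=
  2 * π ^ 2 * (n : ℝ) ^ 4 * ((9 + 4 * (π * (n : ℝ) ^ 2) + 4 * k) ^ k * exp (9 + 4 * k - π * (n : ℝ) ^ 2 * exp (-4)))
  + 3 * π * (n : ℝ) ^ 2 * ((5 + 4 * (π * (n : ℝ) ^ 2) + 4 * k) ^ k * exp (5 + 4 * k - π * (n : ℝ) ^ 2 * exp (-4)))

/-- Auxiliary lemma: `(n k : ℕ) (t : ℝ) (ht : |t| ≤ 1) : |A n k t| ≤ U n k`. [folklore] -/
theorem abs_A_le (n k : ℕ) (t : ℝ) (ht : |t| ≤ 1) : |A n k t| ≤ U n k := by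
  have hc : 0 ≤ π * (n : ℝ) ^ 2 := by positivity
  have h9 := abs_F_le _ hc k 9 t (by norm_num) ht
  have h5 := abs_F_le _ hc k 5 t (by norm_num) ht
  have e1 : (0 : ℝ) ≤ 2 * π ^ 2 * (n : ℝ) ^ 4 := by positivity
  have e2 : (0 : ℝ) ≤ 3 * π * (n : ℝ) ^ 2 := by positivity
  calc |A n k t| ≤ |2 * π ^ 2 * (n : ℝ) ^ 4 * F (π * (n : ℝ) ^ 2) k 9 t|
        + |3 * π * (n : ℝ) ^ 2 * F (π * (n : ℝ) ^ 2) k 5 t| := abs_sub _ _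
    _ = 2 * π ^ 2 * (n : ℝ) ^ 4 * |F (π * (n : ℝ) ^ 2) k 9 t|
        + 3 * π * (n : ℝ) ^ 2 * |F (π * (n : ℝ) ^ 2) k 5 t| := by
        rw [abs_mul (2 * π ^ 2 * (n : ℝ) ^ 4), abs_mul (3 * π * (n : ℝ) ^ 2), abs_of_nonneg e1,
          abs_of_nonneg e2]
    _ ≤ U n k := by unfold U; gcongr

/-- Auxiliary lemma: `(n k : ℕ) : 0 ≤ U n k`. [folklore] -/
theorem U_nonneg (n k : ℕ) : 0 ≤ U n k := by unfold U; positivity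

/-- The constant in the summable majorant `U (n+1) k ≤ Cst k · (n+1)^{2k+4} e^{-π e^{-4} (n+1)}`. [folklore] -/
def Cst (k : ℕ) : ℝ :=
  2 * π ^ 2 * (9 + 4 * π + 4 * k) ^ k * exp (9 + 4 * k) + 3 * π * (5 + 4 * π + 4 * k) ^ k * exp (5 + 4 * k)

/-- Auxiliary lemma: `(n k : ℕ) : U (n + 1) k ≤ Cst k * (((n : ℝ) + 1) ^ (2 * k + 4) * exp (-(π * exp (-4)) * ((n : ℝ) + 1)))`. [folklore] -/
theorem U_succ_le (n k : ℕ) :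
    U (n + 1) k ≤ Cst k * (((n : ℝ) + 1) ^ (2 * k + 4) * exp (-(π * exp (-4)) * ((n : ℝ) + 1))) := by
  have hN : (1 : ℝ) ≤ (n : ℝ) + 1 := by have := n.cast_nonneg (α := ℝ); linarith
  set N : ℝ := (n : ℝ) + 1 with hNdef
  have hcast : ((n + 1 : ℕ) : ℝ) = N := by rw [hNdef]; push_cast; ring
  have hN0 : 0 ≤ N := by linarith
  have hN2 : N ≤ N ^ 2 := by nlinarith
  have hr : 0 < π * exp (-4) := by positivity
  have hk : (0 : ℝ) ≤ 4 * k := by positivity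
  have h1 : (9 + 4 * (π * N ^ 2) + 4 * k) ^ k ≤ ((9 + 4 * π + 4 * k) * N ^ 2) ^ k := by
    apply pow_le_pow_left₀ (by positivity)
    nlinarith [pi_pos, sq_nonneg N]
  have h1' : (5 + 4 * (π * N ^ 2) + 4 * k) ^ k ≤ ((5 + 4 * π + 4 * k) * N ^ 2) ^ k := by
    apply pow_le_pow_left₀ (by positivity)
    nlinarith [pi_pos, sq_nonneg N]
  have h2 : exp (9 + 4 * k - π * N ^ 2 * exp (-4)) ≤ exp (9 + 4 * k) * exp (-(π * exp (-4)) * N) := by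
    rw [← Real.exp_add]; apply exp_le_exp.mpr; nlinarith [exp_pos (-4 : ℝ), pi_pos]
  have h2' : exp (5 + 4 * k - π * N ^ 2 * exp (-4)) ≤ exp (5 + 4 * k) * exp (-(π * exp (-4)) * N) := by
    rw [← Real.exp_add]; apply exp_le_exp.mpr; nlinarith [exp_pos (-4 : ℝ), pi_pos]
  have h3 : N ^ 4 * (N ^ 2) ^ k = N ^ (2 * k + 4) := by rw [← pow_mul, ← pow_add]; ring_nf
  have h4 : N ^ 2 * (N ^ 2) ^ k ≤ N ^ (2 * k + 4) := by
    rw [← pow_mul, ← pow_add]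
    exact pow_le_pow_right₀ hN (by omega)
  simp only [U, Cst, hcast]
  calc 2 * π ^ 2 * N ^ 4 * ((9 + 4 * (π * N ^ 2) + 4 * k) ^ k * exp (9 + 4 * k - π * N ^ 2 * exp (-4)))
        + 3 * π * N ^ 2 * ((5 + 4 * (π * N ^ 2) + 4 * k) ^ k * exp (5 + 4 * k - π * N ^ 2 * exp (-4)))
      ≤ 2 * π ^ 2 * N ^ 4 * (((9 + 4 * π + 4 * k) * N ^ 2) ^ k * (exp (9 + 4 * k) * exp (-(π * exp (-4)) * N)))
        + 3 * π * N ^ 2 * (((5 + 4 * π + 4 * k) * N ^ 2) ^ k * (exp (5 + 4 * k) * exp (-(π * exp (-4)) * N))) := by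
        gcongr
    _ = (2 * π ^ 2 * (9 + 4 * π + 4 * k) ^ k * exp (9 + 4 * k)) * (N ^ 4 * (N ^ 2) ^ k) * exp (-(π * exp (-4)) * N)
        + (3 * π * (5 + 4 * π + 4 * k) ^ k * exp (5 + 4 * k)) * (N ^ 2 * (N ^ 2) ^ k) * exp (-(π * exp (-4)) * N) := by
        rw [mul_pow, mul_pow]; ring
    _ ≤ (2 * π ^ 2 * (9 + 4 * π + 4 * k) ^ k * exp (9 + 4 * k)) * N ^ (2 * k + 4) * exp (-(π * exp (-4)) * N)
        + (3 * π * (5 + 4 * π + 4 * k) ^ k * exp (5 + 4 * k)) * N ^ (2 * k + 4) * exp (-(π * exp (-4)) * N) := by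
        rw [h3]; gcongr
    _ = _ := by ring

/-- Auxiliary lemma: `(k : ℕ) : Summable fun n : ℕ => U (n + 1) k`. [folklore] -/
theorem summable_U (k : ℕ) : Summable fun n : ℕ => U (n + 1) k := by
  have hr : 0 < π * exp (-4) := by positivity
  have hs : Summable fun n : ℕ => ((n : ℝ) + 1) ^ (2 * k + 4) * exp (-(π * exp (-4)) * ((n : ℝ) + 1)) := by
    have := (summable_nat_add_iff 1).mpr (Real.summable_pow_mul_exp_neg_nat_mul (2 * k + 4) hr)
    refine this.congr fun n => ?_
    push_cast; ring_nf
  refine Summable.of_nonneg_of_le (fun n => U_nonneg _ _) (fun n => U_succ_le n k) (hs.mul_left _)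

/-! ## 4. Termwise differentiation of the series on `(-1, 1)` -/

/-- `Φk k t = ∑_{n ≥ 1} a_n^{(k)}(t)`; on `(-1,1)` this is `Φ^{(k)}` (Theorem `iteratedDeriv_eqOn`). [folklore] -/
def Φk (k : ℕ) (t : ℝ) : ℝ := ∑' n : ℕ, A (n + 1) k t

/-- Auxiliary lemma: `: Φk 0 = Φ`. [folklore] -/
theorem Φk_zero : Φk 0 = Φ := by
  funext t; simp [Φk, Φ, A_zero]

/-- Auxiliary lemma: `{t : ℝ} (ht : t ∈ Ioo (-1 : ℝ) 1) : |t| ≤ 1`. [folklore] -/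
theorem abs_le_one_of_mem {t : ℝ} (ht : t ∈ Ioo (-1 : ℝ) 1) : |t| ≤ 1 :=
  abs_le.mpr ⟨ht.1.le, ht.2.le⟩

/-- Auxiliary lemma: `(k : ℕ) {t : ℝ} (ht : |t| ≤ 1) : Summable fun n : ℕ => A (n + 1) k t`. [folklore] -/
theorem summable_A (k : ℕ) {t : ℝ} (ht : |t| ≤ 1) : Summable fun n : ℕ => A (n + 1) k t :=
  Summable.of_norm_bounded (summable_U k) fun n => by
    rw [Real.norm_eq_abs]; exact abs_A_le _ _ _ ht

/-- Auxiliary lemma: `(k : ℕ) {t : ℝ} (ht : t ∈ Ioo (-1 : ℝ) 1) : HasDerivAt (Φk k) (Φk (k + 1) t) t`. [folklore] -/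
theorem hasDerivAt_Φk (k : ℕ) {t : ℝ} (ht : t ∈ Ioo (-1 : ℝ) 1) :
    HasDerivAt (Φk k) (Φk (k + 1) t) t := by
  have h := hasDerivAt_tsum_of_isPreconnected (u := fun n : ℕ => U (n + 1) (k + 1))
    (g := fun (n : ℕ) (z : ℝ) => A (n + 1) k z) (g' := fun (n : ℕ) (z : ℝ) => A (n + 1) (k + 1) z)
    (t := Ioo (-1 : ℝ) 1) (y₀ := 0) (y := t) (summable_U (k + 1)) isOpen_Ioo isPreconnected_Ioo
    (fun n y _ => hasDerivAt_A (n + 1) k y)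
    (fun n y hy => by rw [Real.norm_eq_abs]; exact abs_A_le _ _ _ (abs_le_one_of_mem hy))
    (by norm_num) (summable_A k (t := 0) (by norm_num)) ht
  exact h

/-- Auxiliary lemma: `(k : ℕ) : EqOn (iteratedDeriv k Φ) (Φk k) (Ioo (-1 : ℝ) 1)`. [folklore] -/
theorem iteratedDeriv_eqOn (k : ℕ) : EqOn (iteratedDeriv k Φ) (Φk k) (Ioo (-1 : ℝ) 1) := by
  induction k with
  | zero => intro t _; simp [Φk_zero]
  | succ k ih =>
    intro t ht
    rw [iteratedDeriv_succ]
    have h1 : iteratedDeriv k Φ =ᶠ[𝓝 t] Φk k := ih.eventuallyEq_of_mem (isOpen_Ioo.mem_nhds ht)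
    rw [h1.deriv_eq]
    exact (hasDerivAt_Φk k ht).deriv

/-- The numbers `T k n := a_{n+1}^{(k)}(0)`; `Φ^{(k)}(0) = ∑_n T k n`. [folklore] -/
def T (k n : ℕ) : ℝ := A (n + 1) k 0

/-- Auxiliary lemma: `(k : ℕ) : iteratedDeriv k Φ 0 = ∑' n : ℕ, T k n`. [folklore] -/
theorem iteratedDeriv_zero_eq (k : ℕ) : iteratedDeriv k Φ 0 = ∑' n : ℕ, T k n :=
  iteratedDeriv_eqOn k (by norm_num)

/-- Auxiliary lemma: `(k : ℕ) : Summable (T k)`. [folklore] -/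
theorem summable_T (k : ℕ) : Summable (T k) := summable_A k (by norm_num)

/-- Auxiliary lemma: `(k n : ℕ) : T k n = (2 * π ^ 2 * ((n : ℝ) + 1) ^ 4 * p (π * ((n : ℝ) + 1) ^ 2) k 9 - 3 * π * ((n : ℝ) + 1) ^ 2 * p (π * ((n : ℝ) + 1) ^ 2) k 5) * exp (-(π * ((n : ℝ) + 1) ^ 2))`. [folklore] -/
theorem T_eq (k n : ℕ) : T k n =
    (2 * π ^ 2 * ((n : ℝ) + 1) ^ 4 * p (π * ((n : ℝ) + 1) ^ 2) k 9
      - 3 * π * ((n : ℝ) + 1) ^ 2 * p (π * ((n : ℝ) + 1) ^ 2) k 5) * exp (-(π * ((n : ℝ) + 1) ^ 2)) := by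
  simp only [T, A, F_at_zero]; push_cast; ring_nf

end

end Literature.Analysis.SpecialFunctions.CoffeyCsordas2013
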